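import Mathlib.Analysis.SpecialFunctions.Exponential
import Mathlib.Analysis.Normed.Ring.InfiniteSum
import Mathlib.Analysis.Complex.ExponentialBounds
import HarnessLib

/-!
# The entire function `g(z) = (1 − e^{−z})/z` of the differential of `exp`, on a Banach algebra

Topic `Analysis/Calculus`; namespace `Literature.Analysis.Calculus.ExpDifferential` (the grouping sub-namespace
names the object: the differential `D exp` of the exponential map of a Banach algebra; this file is its
algebraic half, the companion `ExpDifferentialAdSeries` proves `D exp_X = e^X g(ad X)` from it).

The function `g(z) = Σ_{n≥0} ((−1)ⁿ/(n+1)!) zⁿ = (e^{−z} − 1)/(−z)` is the entire function of T. Bałaban,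
*Averaging operations for lattice gauge theories*, CMP 98 (1985), (33) p. 22 [Balaban1985Averaging] (Hall's
`(1 − e^{−z})/z`, [Hall2015] Thm. 5.4), through which the differential of the exponential map is expressed
(«`e^{−A(t)}(d/dt)e^{A(t)} = g(ad_{A(t)})A′(t)`», (32), = [Varadarajan1984] Thm. 2.14.3).  For an element `T` of a
Banach algebra `E` over `𝕂 = ℝ` or `ℂ` this file PROVES (everything `sorry`-free, Mathlib only):

* `gSer 𝕂 T = Σ_{n≥0} (−T)ⁿ/(n+1)!` (absolutely convergent for every `T`: `summable_norm_gSer_term`;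
  `gSer_eq_tsum_neg_one_pow`: `= Σ ((−1)ⁿ/(n+1)!) Tⁿ` as printed; `gSer_zero : g(0) = 1`);
* **(33) as operator identities** `mul_gSer : T · g(T) = 1 − e^{−T}`, `gSer_mul`, and `exp_mul_gSer : e^{T} g(T) = g(−T)`;
* the KEY POLYNOMIAL IDENTITY behind the power-series proof of Theorem 2.14.3 (private `symSum_eq_sum_choose`): for
  COMMUTING `l`, `b` and `symSum l r N := Σ_{k<N} l^k r^{N−1−k}`,
  `Σ_{k<N} l^k (l+b)^{N−1−k} = Σ_{m<N} C(N, m+1) l^{N−1−m} b^m` (induction on `N`: both sides obey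
  `S_{N+1} = (l+b)^N + l·S_N`, by Pascal's rule and the binomial theorem for the commuting pair), and its summed
  form `hasSum_inv_factorial_smul_symSum`: **`Σ_N (1/N!) symSum l r N = exp l · g(l − r)`** for commuting `l, r`
  (Cauchy product of the exponential series of `l` with the `g`-series of `r − l`); at `r = 0` the symmetry
  `l ↔ r` of `symSum` gives `e^{T}g(T) = g(−T)`;
* **(34)** («the function `g⁻¹(z) = 1/g(z)` is an analytic function in a neighborhood of 0 … `g⁻¹(z) = −z/(e^{−z} − 1)`,
  `g⁻¹(−z) = g⁻¹(z) − z`»): `norm_gSer_sub_one_le` (`‖g(T) − 1‖ ≤ (e^{‖T‖} − 1)/2`), `isUnit_gSer` (`g(T)` is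
  invertible for `‖T‖ ≤ 1`), `gInv 𝕂 T := Ring.inverse (g T)` with `gInv_mul_gSer`, `gSer_mul_gInv`,
  `exp_neg_sub_one_mul_gInv : (e^{−T} − 1) g⁻¹(T) = −T` and `gInv_neg : g⁻¹(−T) = g⁻¹(T) − T`.

NOT reproduced here: the Bernoulli-number expansion «`g⁻¹(z) = 1 + ½z + …`», «`f(z) = g⁻¹(z) − ½z` is even» (34)–(35)
(the Taylor data of `g⁻¹` at `0` enter the tree only through `…Balaban1983to89.B7Eq38Remainder.partials_Z2_at_zero`),
and the precise domain «`z ≠ 2kπi`» of (34) (only the disc `‖T‖ ≤ 1` is treated).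

## References

* [Balaban1985Averaging] T. Bałaban, CMP **98** (1985) 17–51, (32)–(34) pp. 22–23.
* [Hall2015] B. C. Hall, *Lie Groups, Lie Algebras, and Representations*, 2nd ed., GTM 222 (2015), §5.4, Thm. 5.4.
* [Varadarajan1984] V. S. Varadarajan, *Lie Groups, Lie Algebras, and Their Representations*, GTM 102, Thm. 2.14.3.
-/

noncomputable section

open NormedSpace Filter Finset
open scoped Topology Nat

namespace Literature.Analysis.Calculus.ExpDifferential

/-! ### §1. The symmetric sums `Σ_{k<N} l^k r^{N−1−k}` and the binomial rearrangement (pure algebra) -/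

section Ring

variable {E : Type*} [Ring E]

/-- `symSum l r N = Σ_{k<N} l^k r^{N−1−k}` — the polarisation of `xᴺ`: for `l, r` = left/right multiplication by
`X` it is the derivative `h ↦ Σ_k X^k h X^{N−1−k}` of `x ↦ xᴺ` at `X`. [folklore] -/
def symSum (l r : E) (N : ℕ) : E := ∑ k ∈ range N, l ^ k * r ^ (N - 1 - k)

/-- `symSum l r 0 = 0` (empty sum). [folklore] -/
@[simp] private theorem symSum_zero (l r : E) : symSum l r 0 = 0 := by simp [symSum]

/-- `symSum l r 1 = 1`. [folklore] -/
@[simp] private theorem symSum_one (l r : E) : symSum l r 1 = 1 := by simp [symSum]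

/-- Left recursion: `symSum l r (N+1) = r^N + l · symSum l r N`. [folklore] -/
private theorem symSum_succ (l r : E) (N : ℕ) : symSum l r (N + 1) = r ^ N + l * symSum l r N := by
  unfold symSum
  rw [sum_range_succ', mul_sum, add_comm]
  simp only [pow_zero, one_mul, Nat.add_sub_cancel, Nat.sub_zero]
  congr 1
  refine sum_congr rfl fun k _ => ?_
  rw [pow_succ', mul_assoc, show N - (k + 1) = N - 1 - k by omega]

/-- Symmetry: for commuting `l, r`, `symSum l r N = symSum r l N`. [folklore] -/
private theorem symSum_comm {l r : E} (h : Commute l r) (N : ℕ) : symSum l r N = symSum r l N := by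
  unfold symSum
  rw [← sum_range_reflect]
  refine sum_congr rfl fun k hk => ?_
  rw [Finset.mem_range] at hk
  rw [show N - 1 - (N - 1 - k) = k by omega]
  exact (h.pow_pow (N - 1 - k) k).eq

/-- `symSum l 0 N = symSum 0 l N` (both equal `l^{N−1}` for `N ≥ 1`, and `0` for `N = 0`). [folklore] -/
private theorem symSum_zero_right (l : E) (N : ℕ) : symSum l 0 N = symSum 0 l N :=
  symSum_comm (Commute.zero_right l) N

/-- **The binomial rearrangement** (the heart of the power-series proof of Theorem 2.14.3): for COMMUTING `l`, `b`,
`Σ_{k<N} l^k (l + b)^{N−1−k} = Σ_{m<N} l^{N−1−m} b^m C(N, m+1)`.  Induction on `N`: both sides obey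
`S_{N+1} = (l+b)^N + l S_N` — the right side by Pascal's rule `C(N+1, m+1) = C(N, m) + C(N, m+1)` and the
binomial theorem for the commuting pair (`Commute.add_pow`). [folklore] -/
private theorem symSum_eq_sum_choose {l b : E} (h : Commute l b) (N : ℕ) :
    symSum l (l + b) N = ∑ m ∈ range N, l ^ (N - 1 - m) * b ^ m * (N.choose (m + 1) : E) := by
  induction N with
  | zero => simp
  | succ N ih =>
    rw [symSum_succ, ih]
    -- Pascal on the right-hand side
    have hP : ∀ m ∈ range (N + 1), l ^ (N + 1 - 1 - m) * b ^ m * ((N + 1).choose (m + 1) : E) =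
        l ^ (N - m) * b ^ m * (N.choose m : E) + l ^ (N - m) * b ^ m * (N.choose (m + 1) : E) := by
      intro m _
      rw [Nat.add_sub_cancel, Nat.choose_succ_succ, Nat.cast_add, mul_add]
    rw [sum_congr rfl hP, sum_add_distrib]
    congr 1
    · -- the binomial theorem for the commuting pair `b`, `l`
      rw [add_comm l b, h.symm.add_pow]
      refine sum_congr rfl fun m hm => ?_
      rw [Finset.mem_range] at hm
      rw [(h.symm.pow_pow m (N - m)).eq]
    · -- the last term vanishes (`C(N, N+1) = 0`), the others carry a factor `l`
      rw [sum_range_succ, Nat.choose_succ_self, Nat.cast_zero, mul_zero, add_zero, mul_sum]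
      refine sum_congr rfl fun m hm => ?_
      rw [Finset.mem_range] at hm
      rw [show N - m = N - 1 - m + 1 by omega, pow_succ', mul_assoc, mul_assoc, mul_assoc]

end Ring

/-! ### §2. The entire function `g(z) = Σ (−1)ⁿzⁿ/(n+1)! = (1 − e^{−z})/z` on a Banach algebra ((33)) -/

section Banach

variable (𝕂 : Type*) [RCLike 𝕂] {E : Type*} [NormedRing E] [NormedAlgebra 𝕂 E] [CompleteSpace E]

/-- `g(T) = Σ_{n≥0} (−T)ⁿ/(n+1)!` for an element `T` of a Banach algebra — the function `g` of
[Balaban1985Averaging] (33) («`g(z) = Σ_{n=0}^∞ ((−1)ⁿ/(n+1)!) zⁿ = (e^{−z} − 1)/(−z)`»), Hall's `(1 − e^{−z})/z`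
(Theorem 5.4), evaluated by the power series («the function `f(ad_X)` can be defined by the power series
expansion», p. 22). [cite: Balaban1985Averaging, (33) p.22] -/
def gSer (T : E) : E := ∑' n : ℕ, ((n + 1)!⁻¹ : 𝕂) • (-T) ^ n

variable {𝕂}

omit [CompleteSpace E] in
/-- The terms of `g` are dominated by those of the exponential series: `‖(−T)ⁿ/(n+1)!‖ ≤ ‖Tⁿ/n!‖`-type bound,
precisely `‖((n+1)!⁻¹ : 𝕂) • (−T)ⁿ‖ ≤ ‖(n!⁻¹ : 𝕂) • (−T)ⁿ‖`. [folklore] -/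
private theorem norm_gSer_term_le (T : E) (n : ℕ) :
    ‖((n + 1)!⁻¹ : 𝕂) • (-T) ^ n‖ ≤ ‖(n !⁻¹ : 𝕂) • (-T) ^ n‖ := by
  rw [norm_smul, norm_smul]
  refine mul_le_mul_of_nonneg_right ?_ (norm_nonneg _)
  rw [norm_inv, norm_inv, RCLike.norm_natCast, RCLike.norm_natCast]
  refine inv_anti₀ (by positivity) ?_
  exact_mod_cast Nat.factorial_le (Nat.le_succ n)

omit [CompleteSpace E] in
/-- The `g`-series converges absolutely on the whole Banach algebra (`g` is entire).
[cite: Balaban1985Averaging, (33) p.22] -/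
theorem summable_norm_gSer_term (T : E) : Summable fun n : ℕ => ‖((n + 1)!⁻¹ : 𝕂) • (-T) ^ n‖ :=
  Summable.of_nonneg_of_le (fun _ => norm_nonneg _) (norm_gSer_term_le T) (norm_expSeries_summable' (-T))

/-- The `g`-series converges. [cite: Balaban1985Averaging, (33) p.22] -/
theorem summable_gSer_term (T : E) : Summable fun n : ℕ => ((n + 1)!⁻¹ : 𝕂) • (-T) ^ n :=
  (summable_norm_gSer_term (𝕂 := 𝕂) T).of_norm

/-- `HasSum` form of the definition of `g(T)`. [cite: Balaban1985Averaging, (33) p.22] -/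
theorem hasSum_gSer (T : E) : HasSum (fun n : ℕ => ((n + 1)!⁻¹ : 𝕂) • (-T) ^ n) (gSer 𝕂 T) :=
  (summable_gSer_term T).hasSum

omit [CompleteSpace E] in
/-- The printed form of (33): `g(T) = Σ_{n≥0} ((−1)ⁿ/(n+1)!) Tⁿ`. [cite: Balaban1985Averaging, (33) p.22] -/
theorem gSer_eq_tsum_neg_one_pow (T : E) :
    gSer 𝕂 T = ∑' n : ℕ, ((-1) ^ n * ((n + 1)! : 𝕂)⁻¹) • T ^ n := by
  unfold gSer
  refine tsum_congr fun n => ?_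
  rw [show -T = (-1 : 𝕂) • T by simp, smul_pow, smul_smul, mul_comm]

/-- Summability of the printed form `Σ ((−1)ⁿ/(n+1)!) Tⁿ`. [cite: Balaban1985Averaging, (33) p.22] -/
theorem summable_gSer_term' (T : E) : Summable fun n : ℕ => ((-1) ^ n * ((n + 1)! : 𝕂)⁻¹) • T ^ n := by
  refine (summable_gSer_term (𝕂 := 𝕂) T).congr fun n => ?_
  rw [show -T = (-1 : 𝕂) • T by simp, smul_pow, smul_smul, mul_comm]

/-- `g(0) = 1` («`g(0) = 1`», (33)). [cite: Balaban1985Averaging, (33) p.22] -/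
@[simp] theorem gSer_zero : gSer 𝕂 (0 : E) = 1 := by
  have h : HasSum (fun n : ℕ => ((n + 1)!⁻¹ : 𝕂) • (-(0 : E)) ^ n) 1 := by
    have h1 : (fun n : ℕ => ((n + 1)!⁻¹ : 𝕂) • (-(0 : E)) ^ n) = fun n => if n = 0 then 1 else 0 := by
      funext n
      rcases n with _ | n
      · simp
      · simp
    rw [h1]
    exact hasSum_ite_eq 0 1
  exact (hasSum_gSer (𝕂 := 𝕂) (0 : E)).unique h

include 𝕂 in
/-- `e^{−X} e^{X} = 1` («`e^X` is invertible and `(e^X)⁻¹ = e^{−X}`»). [cite: Hall2015, Prop 2.3] -/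
theorem exp_neg_mul_exp_eq_one (X : E) : exp (-X) * exp X = 1 := by
  have h := exp_add_of_commute_of_mem_ball (𝕂 := 𝕂) ((Commute.refl X).neg_left)
    (by simp [expSeries_radius_eq_top]) (by simp [expSeries_radius_eq_top])
  rw [neg_add_cancel, exp_zero] at h
  exact h.symm

include 𝕂 in
/-- `e^{X} e^{−X} = 1`. [cite: Hall2015, Prop 2.3] -/
theorem exp_mul_exp_neg_eq_one (X : E) : exp X * exp (-X) = 1 := by
  simpa using exp_neg_mul_exp_eq_one (𝕂 := 𝕂) (-X)

/-- **(33) as an operator identity**: `T · g(T) = 1 − e^{−T}` (so `g(z) = (1 − e^{−z})/z` wherever `z` is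
invertible). [cite: Balaban1985Averaging, (33) p.22] -/
theorem mul_gSer (T : E) : T * gSer 𝕂 T = 1 - exp (-T) := by
  have hs := summable_gSer_term (𝕂 := 𝕂) T
  have he : HasSum (fun n : ℕ => (n !⁻¹ : 𝕂) • (-T) ^ n) (exp (-T)) := exp_series_hasSum_exp' (-T)
  -- shift the exponential series by one
  have he' : HasSum (fun n : ℕ => ((n + 1)!⁻¹ : 𝕂) • (-T) ^ (n + 1)) (exp (-T) - 1) := by
    have := (hasSum_nat_add_iff' 1).mpr he
    simpa using this
  have hT : HasSum (fun n : ℕ => T * (((n + 1)!⁻¹ : 𝕂) • (-T) ^ n)) (T * gSer 𝕂 T) :=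
    (hasSum_gSer (𝕂 := 𝕂) T).mul_left T
  have hkey : (fun n : ℕ => T * (((n + 1)!⁻¹ : 𝕂) • (-T) ^ n)) =
      fun n => -(((n + 1)!⁻¹ : 𝕂) • (-T) ^ (n + 1)) := by
    funext n
    rw [mul_smul_comm, pow_succ', ← smul_neg, neg_mul, neg_neg]
  rw [hkey] at hT
  have := hT.unique he'.neg
  rw [this, neg_sub]

/-- (33), right-handed: `g(T) · T = 1 − e^{−T}`. [cite: Balaban1985Averaging, (33) p.22] -/
theorem gSer_mul (T : E) : gSer 𝕂 T * T = 1 - exp (-T) := by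
  have he : HasSum (fun n : ℕ => (n !⁻¹ : 𝕂) • (-T) ^ n) (exp (-T)) := exp_series_hasSum_exp' (-T)
  have he' : HasSum (fun n : ℕ => ((n + 1)!⁻¹ : 𝕂) • (-T) ^ (n + 1)) (exp (-T) - 1) := by
    have := (hasSum_nat_add_iff' 1).mpr he
    simpa using this
  have hT : HasSum (fun n : ℕ => (((n + 1)!⁻¹ : 𝕂) • (-T) ^ n) * T) (gSer 𝕂 T * T) :=
    (hasSum_gSer (𝕂 := 𝕂) T).mul_right T
  have hkey : (fun n : ℕ => (((n + 1)!⁻¹ : 𝕂) • (-T) ^ n) * T) =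
      fun n => -(((n + 1)!⁻¹ : 𝕂) • (-T) ^ (n + 1)) := by
    funext n
    rw [smul_mul_assoc, pow_succ, ← smul_neg, mul_neg, neg_neg]
  rw [hkey] at hT
  have := hT.unique he'.neg
  rw [this, neg_sub]

/-- `T` commutes with `g(T)`. [folklore] -/
private theorem commute_gSer (T : E) : Commute T (gSer 𝕂 T) := by
  rw [Commute, SemiconjBy, mul_gSer, gSer_mul]

/-! ### §3. `Σ_N (1/N!) symSum l r N = exp l · g(l − r)` for a commuting pair (Cauchy product) -/

/-- Factorial bookkeeping: `(1/N!) C(N, m+1) = 1/((m+1)! (N−1−m)!)` for `m < N`. [folklore] -/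
private theorem inv_factorial_mul_choose {N m : ℕ} (hm : m < N) :
    (N !⁻¹ : 𝕂) * (N.choose (m + 1) : 𝕂) = ((m + 1)!⁻¹ : 𝕂) * ((N - 1 - m)!⁻¹ : 𝕂) := by
  have h := Nat.choose_mul_factorial_mul_factorial (show m + 1 ≤ N by omega)
  rw [show N - (m + 1) = N - 1 - m by omega] at h
  have hN : (N ! : 𝕂) ≠ 0 := by exact_mod_cast (Nat.factorial_pos N).ne'
  have h1 : ((m + 1)! : 𝕂) ≠ 0 := by exact_mod_cast (Nat.factorial_pos (m + 1)).ne'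
  have h2 : ((N - 1 - m)! : 𝕂) ≠ 0 := by exact_mod_cast (Nat.factorial_pos (N - 1 - m)).ne'
  have h' : (N.choose (m + 1) : 𝕂) * ((m + 1)! : 𝕂) * ((N - 1 - m)! : 𝕂) = (N ! : 𝕂) := by
    exact_mod_cast h
  field_simp
  linear_combination h'

omit [CompleteSpace E] in
/-- The degree-`N` term, normalised: for commuting `l`, `b` and `N = n + 1`,
`(1/N!) symSum l (l+b) N = Σ_{k ≤ n} (l^k/k!) · (b^{n−k}/(n−k+1)!)`. [folklore] -/
private theorem inv_factorial_smul_symSum_succ {l b : E} (h : Commute l b) (n : ℕ) :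
    ((n + 1)!⁻¹ : 𝕂) • symSum l (l + b) (n + 1) =
      ∑ k ∈ range (n + 1), ((k !⁻¹ : 𝕂) • l ^ k) * (((n - k + 1)!⁻¹ : 𝕂) • b ^ (n - k)) := by
  rw [symSum_eq_sum_choose h, smul_sum]
  conv_rhs => rw [← sum_range_reflect]
  refine sum_congr rfl fun m hm => ?_
  rw [Finset.mem_range] at hm
  rw [Nat.add_sub_cancel, show n - (n - m) = m by omega, ← nsmul_eq_mul', ← Nat.cast_smul_eq_nsmul 𝕂,
    smul_smul, smul_mul_smul_comm, inv_factorial_mul_choose (𝕂 := 𝕂) hm, Nat.add_sub_cancel, mul_comm]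

/-- **`Σ_N (1/N!) symSum l r N = exp l · g(l − r)`** for a commuting pair `l`, `r` of a Banach algebra: the
binomial rearrangement summed against `1/N!` is the Cauchy product of the exponential series of `l` with the
`g`-series of `r − l`.  This is the universal form of Theorem 5.4 / (5.10) «`(d/dt)e^{X+tY}|₀ = e^X{(I − e^{−ad_X})/ad_X}(Y)`»:
with `l = L_X`, `r = R_X` (left/right multiplication, `ad_X = L_X − R_X`) applied to `Y` it is that formula
(`ExpDifferentialAdSeries.hasSum_dexp`). [cite: Hall2015, Thm 5.4] -/
theorem hasSum_inv_factorial_smul_symSum {l r : E} (h : Commute l r) :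
    HasSum (fun N : ℕ => (N !⁻¹ : 𝕂) • symSum l r N) (exp l * gSer 𝕂 (l - r)) := by
  set b := r - l with hb
  have hlb : Commute l b := h.sub_right (Commute.refl l)
  have hr : r = l + b := by rw [hb]; abel
  have hf : Summable fun n : ℕ => ‖(n !⁻¹ : 𝕂) • l ^ n‖ := norm_expSeries_summable' l
  have hg : Summable fun n : ℕ => ‖((n + 1)!⁻¹ : 𝕂) • b ^ n‖ := by
    simpa using summable_norm_gSer_term (𝕂 := 𝕂) (-b)
  have hprod := hasSum_sum_range_mul_of_summable_norm hf hg
  have hexp : ∑' n : ℕ, (n !⁻¹ : 𝕂) • l ^ n = exp l := (congrFun (exp_eq_tsum 𝕂) l).symm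
  have hgs : ∑' n : ℕ, ((n + 1)!⁻¹ : 𝕂) • b ^ n = gSer 𝕂 (l - r) := by
    rw [gSer, neg_sub]
  rw [hexp, hgs] at hprod
  have hshift : HasSum (fun n : ℕ => ((n + 1)!⁻¹ : 𝕂) • symSum l r (n + 1)) (exp l * gSer 𝕂 (l - r)) := by
    convert hprod using 1
    funext n
    rw [hr, inv_factorial_smul_symSum_succ hlb n]
  refine (hasSum_nat_add_iff' 1).mp ?_
  simpa using hshift

/-- **`e^{T} g(T) = g(−T)`** (the identity `e^{z}(1 − e^{−z})/z = (e^{z} − 1)/z`, as an identity of operators; it is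
the symmetry `l ↔ r` of `symSum` at `r = 0`). [cite: Balaban1985Averaging, (33)–(34) p.22–23] -/
theorem exp_mul_gSer (T : E) : exp T * gSer 𝕂 T = gSer 𝕂 (-T) := by
  have h1 := hasSum_inv_factorial_smul_symSum (𝕂 := 𝕂) (Commute.zero_right T)
  have h2 := hasSum_inv_factorial_smul_symSum (𝕂 := 𝕂) (Commute.zero_left T)
  simp only [sub_zero, zero_sub, exp_zero, one_mul] at h1 h2
  have h3 : (fun N : ℕ => (N !⁻¹ : 𝕂) • symSum T 0 N) = fun N => (N !⁻¹ : 𝕂) • symSum 0 T N := by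
    funext N; rw [symSum_zero_right]
  rw [h3] at h1
  exact h1.unique h2

end Banach

/-! ### §4. (34): `g⁻¹ = 1/g` near `0` — invertibility of `g(T)` for `‖T‖ ≤ 1` -/

section Inverse

variable (𝕂 : Type*) [RCLike 𝕂] {E : Type*} [NormedRing E] [NormedAlgebra 𝕂 E] [CompleteSpace E]

/-- `g⁻¹(T) := (g(T))⁻¹` (the ring inverse; meaningful when `g(T)` is invertible, e.g. `‖T‖ ≤ 1`, `isUnit_gSer`) —
«the function `g⁻¹(z) = 1/g(z)` is an analytic function in a neighborhood of `0`» (p. 23).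
[cite: Balaban1985Averaging, (34) p.23] -/
def gInv (T : E) : E := Ring.inverse (gSer 𝕂 T)

variable {𝕂}

/-- The real exponential series shifted by one: `Σ_n x^{n+1}/(n+1)! = e^x − 1`. [folklore] -/
private theorem hasSum_pow_succ_div_factorial (x : ℝ) :
    HasSum (fun n : ℕ => x ^ (n + 1) / (n + 1)!) (Real.exp x - 1) := by
  have h : HasSum (fun n : ℕ => x ^ n / n !) (Real.exp x) := by
    rw [Real.exp_eq_exp_ℝ]
    exact expSeries_div_hasSum_exp x
  have := (hasSum_nat_add_iff' 1).mpr h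
  simpa using this

/-- **`‖g(T) − 1‖ ≤ (e^{‖T‖} − 1)/2`**: `g(T) − 1 = Σ_{n≥1} (−T)ⁿ/(n+1)!` and `(n+1)! ≥ 2·n!`.
[cite: Balaban1985Averaging, (34) p.23] -/
theorem norm_gSer_sub_one_le (T : E) : ‖gSer 𝕂 T - 1‖ ≤ (Real.exp ‖T‖ - 1) / 2 := by
  have hshift : HasSum (fun n : ℕ => ((n + 1 + 1)!⁻¹ : 𝕂) • (-T) ^ (n + 1)) (gSer 𝕂 T - 1) := by
    have := (hasSum_nat_add_iff' 1).mpr (hasSum_gSer (𝕂 := 𝕂) T)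
    simpa using this
  rw [← hshift.tsum_eq]
  refine tsum_of_norm_bounded ((hasSum_pow_succ_div_factorial ‖T‖).div_const 2) fun n => ?_
  rw [norm_smul, norm_inv, RCLike.norm_natCast]
  have hfac : (2 : ℝ) * (n + 1)! ≤ (n + 1 + 1)! := by
    rw [Nat.factorial_succ (n + 1)]; push_cast; nlinarith [(Nat.factorial_pos (n + 1) : 0 < (n + 1)!)]
  have hpow : ‖(-T) ^ (n + 1)‖ ≤ ‖T‖ ^ (n + 1) := by
    simpa [norm_neg] using norm_pow_le' (-T) (Nat.succ_pos n)
  have h1 : (0 : ℝ) < (n + 1 + 1)! := by exact_mod_cast Nat.factorial_pos _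
  have h2 : (0 : ℝ) < (n + 1)! := by exact_mod_cast Nat.factorial_pos _
  calc ((n + 1 + 1)! : ℝ)⁻¹ * ‖(-T) ^ (n + 1)‖ ≤ ((n + 1 + 1)! : ℝ)⁻¹ * ‖T‖ ^ (n + 1) :=
        mul_le_mul_of_nonneg_left hpow (by positivity)
    _ ≤ (2 * (n + 1)! : ℝ)⁻¹ * ‖T‖ ^ (n + 1) :=
        mul_le_mul_of_nonneg_right (inv_anti₀ (by positivity) hfac) (by positivity)
    _ = ‖T‖ ^ (n + 1) / (n + 1)! / 2 := by field_simp

/-- **(34): `g(T)` is invertible for `‖T‖ ≤ 1`** (`‖g(T) − 1‖ ≤ (e − 1)/2 < 1`). [cite: Balaban1985Averaging, (34) p.23] -/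
theorem isUnit_gSer {T : E} (hT : ‖T‖ ≤ 1) : IsUnit (gSer 𝕂 T) := by
  have hlt : ‖1 - gSer 𝕂 T‖ < 1 := by
    rw [norm_sub_rev]
    refine (norm_gSer_sub_one_le T).trans_lt ?_
    have h1 : Real.exp ‖T‖ ≤ Real.exp 1 := Real.exp_le_exp.2 hT
    have h2 := Real.exp_one_lt_d9
    linarith
  have h := (Units.oneSub (1 - gSer 𝕂 T) hlt).isUnit
  simpa using h

/-- `g⁻¹(T) g(T) = 1` for `‖T‖ ≤ 1`. [cite: Balaban1985Averaging, (34) p.23] -/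
theorem gInv_mul_gSer {T : E} (hT : ‖T‖ ≤ 1) : gInv 𝕂 T * gSer 𝕂 T = 1 :=
  Ring.inverse_mul_cancel _ (isUnit_gSer hT)

/-- `g(T) g⁻¹(T) = 1` for `‖T‖ ≤ 1`. [cite: Balaban1985Averaging, (34) p.23] -/
theorem gSer_mul_gInv {T : E} (hT : ‖T‖ ≤ 1) : gSer 𝕂 T * gInv 𝕂 T = 1 :=
  Ring.mul_inverse_cancel _ (isUnit_gSer hT)

/-- (34), first identity, as operators: «`g⁻¹(z) = −z/(e^{−z} − 1)`», i.e. `(e^{−T} − 1) g⁻¹(T) = −T`.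
[cite: Balaban1985Averaging, (34) p.23] -/
theorem exp_neg_sub_one_mul_gInv {T : E} (hT : ‖T‖ ≤ 1) : (exp (-T) - 1) * gInv 𝕂 T = -T := by
  have h : T * gSer 𝕂 T * gInv 𝕂 T = T := by rw [mul_assoc, gSer_mul_gInv hT, mul_one]
  rw [mul_gSer] at h
  calc (exp (-T) - 1) * gInv 𝕂 T = -((1 - exp (-T)) * gInv 𝕂 T) := by rw [← neg_sub, neg_mul]
    _ = -T := by rw [h]

/-- (34), second identity: «`g⁻¹(−z) = g⁻¹(z) − z`», as operators for `‖T‖ ≤ 1`: `g⁻¹(−T) = g⁻¹(T) − T`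
(from `g(−T) = e^{T} g(T)` and `T g(T) = 1 − e^{−T}`). [cite: Balaban1985Averaging, (34) p.23] -/
theorem gInv_neg {T : E} (hT : ‖T‖ ≤ 1) : gInv 𝕂 (-T) = gInv 𝕂 T - T := by
  have hT' : ‖-T‖ ≤ 1 := by rwa [norm_neg]
  obtain ⟨u, hu⟩ := isUnit_gSer (𝕂 := 𝕂) hT'
  have hcomm : exp T * gSer 𝕂 T = gSer 𝕂 T * exp T := (Commute.exp_left (commute_gSer (𝕂 := 𝕂) T)).eq
  have hleft : (gInv 𝕂 T - T) * gSer 𝕂 (-T) = 1 := by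
    rw [← exp_mul_gSer, hcomm, ← mul_assoc, sub_mul (gInv 𝕂 T) T (gSer 𝕂 T), gInv_mul_gSer hT, mul_gSer,
      sub_mul, one_mul, sub_mul, one_mul, exp_neg_mul_exp_eq_one (𝕂 := 𝕂)]
    abel
  rw [gInv, ← hu, Ring.inverse_unit]
  rw [← hu] at hleft
  calc (↑u⁻¹ : E) = (gInv 𝕂 T - T) * (↑u * ↑u⁻¹) := by rw [← mul_assoc, hleft, one_mul]
    _ = gInv 𝕂 T - T := by rw [Units.mul_inv, mul_one]

end Inverse

end Literature.Analysis.Calculus.ExpDifferential
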